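import Mathlib.Analysis.SpecialFunctions.Pow.Real
import Mathlib.Analysis.SpecialFunctions.Sqrt
import HarnessLib

/-!
# Crux `RigidMomentumBound` (stmt-AtomisticToContinuum-13034), line `registered`, soft-core side-result:
# linearisation of the pair-counting inequalities

Supports (does not close) stmt-AtomisticToContinuum-13034. Pure real analysis: from the two
combinatorial inequalities of `stub_pairCounting` — `n*² ≤ 2MA + Mn*` (cells) and
`S² ≤ N(2MA·n* + MS)` (double counting + Cauchy–Schwarz), where `A` is the number of close pairs,
`n*` the maximal number of `2R`-neighbours and `S = ∑ᵢ nᵢ = N + 2·#{pairs within 2R}` — we derive the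
bound LINEAR in `A`

  `S ≤ 3 M N^{1/4} (N + A)`   (`N, M ≥ 1`),

by `n* ≤ M + √(2MA)`, `S ≤ MN + √α`, `√(x+y) ≤ √x + √y`, AM–GM `2t²u ≤ t³ + tu²` and the quartic
AM–GM `4tw³ ≤ 3w⁴ + t⁴` (`t = N^{1/4}`, `u = √A`, `w = √u`). Linearity in `A` is what allows taking
expectations (`𝔼A` is controlled by the energy of a soft-core potential, `𝔼A^{3/2}` is not).
Folklore.
-/

noncomputable section

namespace Summit.AtomisticToContinuum.BoseEinsteinCondensation.Theorems.RigidMomentumBound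

namespace SoftCore

/-- Root bound for `t² ≤ b t + c`: `t ≤ b + √c` (`b, c ≥ 0`). [folklore] -/
theorem le_add_sqrt_of_sq_le {t b c : ℝ} (hb : 0 ≤ b) (hc : 0 ≤ c)
    (h : t ^ 2 ≤ b * t + c) : t ≤ b + Real.sqrt c := by
  by_contra hlt
  have hlt' : b + Real.sqrt c < t := lt_of_not_ge hlt
  have hs : Real.sqrt c ^ 2 = c := Real.sq_sqrt hc
  have hs0 : 0 ≤ Real.sqrt c := Real.sqrt_nonneg c
  have ht0 : 0 < t := by linarith
  -- `t > b + √c ≥ √c`, so `t² > t (b + √c) ≥ b t + √c · √c = b t + c`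
  have h1 : (b + Real.sqrt c) * t < t * t := mul_lt_mul_of_pos_right hlt' ht0
  have h2 : Real.sqrt c * Real.sqrt c ≤ Real.sqrt c * t :=
    mul_le_mul_of_nonneg_left (by linarith) hs0
  nlinarith

/-- The quartic AM–GM `4 t w³ ≤ 3 w⁴ + t⁴` (all real `t, w`: the difference is
`(w - t)²(2w² + (w + t)²)`). [folklore] -/
theorem four_mul_mul_cube_le (t w : ℝ) : 4 * t * w ^ 3 ≤ 3 * w ^ 4 + t ^ 4 := by
  have h : 3 * w ^ 4 + t ^ 4 - 4 * t * w ^ 3 = (w - t) ^ 2 * (2 * w ^ 2 + (w + t) ^ 2) := by ring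
  nlinarith [mul_nonneg (sq_nonneg (w - t)) (add_nonneg (mul_nonneg zero_le_two (sq_nonneg w))
    (sq_nonneg (w + t)))]

/-- **Linearisation of the pair-counting inequalities.** If `M, N ≥ 1`, `A, n* ≥ 0`,
`n*² ≤ 2MA + Mn*` and `S² ≤ N(2MA·n* + MS)`, then `S ≤ 3 M N^{1/4} (N + A)` (with
`N^{1/4} = √√N`). (Registered sub-goal anchoring this helper file on the crux item; header kept on
one logical line for the verbatim registration.) [folklore] -/
theorem pairSum_le_linear : ∀ {N M A S nstar : ℝ}, 1 ≤ M → 1 ≤ N → 0 ≤ A → 0 ≤ nstar → nstar ^ 2 ≤ 2 * M * A + M * nstar → S ^ 2 ≤ N * (2 * M * A * nstar + M * S) → S ≤ 3 * M * Real.sqrt (Real.sqrt N) * (N + A) := by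
  intro N M A S nstar hM hN hA hn h1 h2
  have hM0 : 0 ≤ M := by linarith
  have hN0 : 0 ≤ N := by linarith
  -- `t = N^{1/4}`, `u = √A`, `w = √u`
  set t := Real.sqrt (Real.sqrt N) with ht
  set u := Real.sqrt A with hu
  set w := Real.sqrt u with hw
  have ht0 : 0 ≤ t := Real.sqrt_nonneg _
  have hu0 : 0 ≤ u := Real.sqrt_nonneg _
  have hw0 : 0 ≤ w := Real.sqrt_nonneg _
  have ht4 : t ^ 4 = N := by
    -- `(√√N)⁴ = N` (the tree's `Literature.NumberTheory.LFunctions.ZeroDensity.sqrt_sqrt_pow_four`, inlined)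
    have h2 : t ^ 2 = Real.sqrt N := Real.sq_sqrt (Real.sqrt_nonneg N)
    calc t ^ 4 = (t ^ 2) ^ 2 := by ring
      _ = N := by rw [h2, Real.sq_sqrt hN0]
  have hu2 : u ^ 2 = A := Real.sq_sqrt hA
  have hw2 : w ^ 2 = u := Real.sq_sqrt hu0
  have ht1 : 1 ≤ t := by
    have h := Real.sqrt_le_sqrt (Real.sqrt_le_sqrt hN)
    rwa [Real.sqrt_one, Real.sqrt_one] at h
  -- (a) `n* ≤ M + √(2M) u`
  have hsq2MA : Real.sqrt (2 * M * A) = Real.sqrt (2 * M) * u := by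
    rw [hu, ← Real.sqrt_mul (by positivity)]
  have hna : nstar ≤ M + Real.sqrt (2 * M) * u := by
    have h1' : nstar ^ 2 ≤ M * nstar + 2 * M * A := by linarith
    have := le_add_sqrt_of_sq_le (t := nstar) hM0 (by positivity : (0 : ℝ) ≤ 2 * M * A) h1'
    rwa [hsq2MA] at this
  have hs2M : Real.sqrt (2 * M) ≤ 2 * M := by
    rw [Real.sqrt_le_left (by positivity)]
    nlinarith
  -- (b) `S ≤ MN + √α`, `α = N · 2MA · n*`
  have hα0 : 0 ≤ N * (2 * M * A * nstar) := by positivity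
  have hSb : S ≤ M * N + Real.sqrt (N * (2 * M * A * nstar)) :=
    le_add_sqrt_of_sq_le (by positivity) hα0 (h2.trans_eq (by ring))
  -- (c) `α ≤ 2M²N u² + 4M²N u³`, so `√α ≤ √2 M t² u + 2M t² u w`
  set x := Real.sqrt 2 * M * t ^ 2 * u with hx
  set y := 2 * M * t ^ 2 * u * w with hy
  have hx0 : 0 ≤ x := by positivity
  have hy0 : 0 ≤ y := by positivity
  have hs22 : Real.sqrt 2 ^ 2 = 2 := Real.sq_sqrt (by norm_num)
  have e1 : x ^ 2 = 2 * M ^ 2 * N * A := by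
    calc x ^ 2 = Real.sqrt 2 ^ 2 * M ^ 2 * t ^ 4 * u ^ 2 := by rw [hx]; ring
      _ = 2 * M ^ 2 * N * A := by rw [hs22, ht4, hu2]
  have e2 : y ^ 2 = 4 * M ^ 2 * N * (A * u) := by
    calc y ^ 2 = 4 * M ^ 2 * t ^ 4 * u ^ 2 * w ^ 2 := by rw [hy]; ring
      _ = 4 * M ^ 2 * N * (A * u) := by rw [ht4, hu2, hw2]; ring
  have hα : N * (2 * M * A * nstar) ≤ x ^ 2 + y ^ 2 := by
    rw [e1, e2]
    have hNA : 0 ≤ N * (2 * M * A) := by positivity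
    have h3 : N * (2 * M * A * nstar) ≤ N * (2 * M * A) * (M + Real.sqrt (2 * M) * u) := by
      rw [show N * (2 * M * A * nstar) = N * (2 * M * A) * nstar by ring]
      exact mul_le_mul_of_nonneg_left hna hNA
    have h4 : N * (2 * M * A) * (Real.sqrt (2 * M) * u) ≤ N * (2 * M * A) * (2 * M * u) :=
      mul_le_mul_of_nonneg_left (mul_le_mul_of_nonneg_right hs2M hu0) hNA
    have h5 : N * (2 * M * A) * (M + Real.sqrt (2 * M) * u) =
        2 * M ^ 2 * N * A + N * (2 * M * A) * (Real.sqrt (2 * M) * u) := by ring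
    have h6 : N * (2 * M * A) * (2 * M * u) = 4 * M ^ 2 * N * (A * u) := by ring
    linarith
  have hsqrtα : Real.sqrt (N * (2 * M * A * nstar)) ≤ x + y := by
    rw [Real.sqrt_le_left (by positivity)]
    nlinarith [mul_nonneg hx0 hy0]
  -- (d) AM–GM: `2 t² u ≤ t³ + t u²` and `4 t² u w ≤ 3 t u² + t⁵`
  have hamgm1 : 2 * (t ^ 2 * u) ≤ t ^ 3 + t * u ^ 2 := by
    have : 0 ≤ t * (t - u) ^ 2 := mul_nonneg ht0 (sq_nonneg _)
    nlinarith
  have hamgm2 : 4 * (t ^ 2 * u * w) ≤ 3 * t * u ^ 2 + t ^ 5 := by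
    have h := four_mul_mul_cube_le t w
    have hw3 : w ^ 3 = u * w := by
      calc w ^ 3 = w ^ 2 * w := by ring
        _ = u * w := by rw [hw2]
    have hw4 : w ^ 4 = u ^ 2 := by
      calc w ^ 4 = (w ^ 2) ^ 2 := by ring
        _ = u ^ 2 := by rw [hw2]
    rw [hw3, hw4] at h
    -- multiply `4 t (u w) ≤ 3 u² + t⁴` by `t ≥ 0`
    have h' := mul_le_mul_of_nonneg_left h ht0
    have e3 : t * (4 * t * (u * w)) = 4 * (t ^ 2 * u * w) := by ring
    have e4 : t * (3 * u ^ 2 + t ^ 4) = 3 * t * u ^ 2 + t ^ 5 := by ring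
    linarith
  -- (e) collect
  have hs2le : Real.sqrt 2 ≤ 2 := by
    rw [Real.sqrt_le_left (by norm_num)]; norm_num
  have ht5 : t ^ 5 = N * t := by rw [← ht4]; ring
  have ht3 : t ^ 3 ≤ N * t := by
    have h12 : (1 : ℝ) ≤ t ^ 2 := by nlinarith
    calc t ^ 3 = t ^ 3 * 1 := (mul_one _).symm
      _ ≤ t ^ 3 * t ^ 2 := mul_le_mul_of_nonneg_left h12 (by positivity)
      _ = N * t := by rw [← ht4]; ring
  have hNt : N ≤ N * t := le_mul_of_one_le_right hN0 ht1
  have ex1 : x ≤ 2 * M * (t ^ 2 * u) := by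
    rw [hx, show Real.sqrt 2 * M * t ^ 2 * u = Real.sqrt 2 * (M * (t ^ 2 * u)) by ring,
      show 2 * M * (t ^ 2 * u) = 2 * (M * (t ^ 2 * u)) by ring]
    exact mul_le_mul_of_nonneg_right hs2le (by positivity)
  have ey : y = 2 * M * (t ^ 2 * u * w) := by rw [hy]; ring
  have hMtu : M * (2 * (t ^ 2 * u)) ≤ M * (t ^ 3 + t * u ^ 2) := mul_le_mul_of_nonneg_left hamgm1 hM0
  have hMtuw : M * (4 * (t ^ 2 * u * w)) ≤ M * (3 * t * u ^ 2 + t ^ 5) :=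
    mul_le_mul_of_nonneg_left hamgm2 hM0
  have hMt3 : M * t ^ 3 ≤ M * (N * t) := mul_le_mul_of_nonneg_left ht3 hM0
  have hMN : M * N ≤ M * (N * t) := mul_le_mul_of_nonneg_left hNt hM0
  have htA : 0 ≤ M * (t * A) := by positivity
  calc S ≤ M * N + Real.sqrt (N * (2 * M * A * nstar)) := hSb
    _ ≤ M * N + (x + y) := by linarith
    _ ≤ M * N + 2 * M * (t ^ 2 * u) + 2 * M * (t ^ 2 * u * w) := by linarith
    _ ≤ M * N + M * (t ^ 3 + t * u ^ 2) + M * (3 * t * u ^ 2 + t ^ 5) / 2 := by linarith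
    _ = M * N + M * t ^ 3 + (5 / 2) * (M * (t * A)) + (1 / 2) * (M * t ^ 5) := by rw [hu2]; ring
    _ ≤ M * (N * t) + M * (N * t) + (5 / 2) * (M * (t * A)) + (1 / 2) * (M * (N * t)) := by
        rw [ht5]; linarith
    _ ≤ 3 * M * t * (N + A) := by
        have hMNt : 0 ≤ M * (N * t) := by positivity
        have e : 3 * M * t * (N + A) = 3 * (M * (N * t)) + 3 * (M * (t * A)) := by ring
        rw [e]; linarith

end SoftCore

end Summit.AtomisticToContinuum.BoseEinsteinCondensation.Theorems.RigidMomentumBound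

end
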